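import Summits.CriticalPhenomena.PercolationContinuityZ3.Theorems.PercNearOneGluingNearOneGluingS2OfS2M
import Literature.Probability.Percolation.TwoClusterConditionalAssociationProofs

/-!
# Crux `PercNearOneGluing.NearOneGluing` (stmt-CriticalPhenomena-4574), line `SketchR2I5` —
# S2 is an instance of the general-test-function form of S1

Lead prover-line-stmt-CriticalPhenomena-4574-c7 (cycle 7, wave 4, stub-worker W7).  Lands
`--supports stmt-CriticalPhenomena-4574`; no definitions, no named facts.

## Content

Finite weighted graph on `Fin n`, `μ = prodBernoulli w`, `{u ↔ v} = openConn u v`, `C_y(ω) = openEdgeCluster ω y`;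
`D := {y ↮ z}`, `D_a := {x ↮ y} ∩ {x ↮ z}`, `W := D_a ∩ {o ↔ x}` (`θ = μ(W)/μ(D_a)`).
The registered stubs of the line are the two exchange inequalities given `y ↮ z`
* S1: `Cov_D(1{o↔y}, 1{y↔b}) ≥ θ·Cov_D(1{x↔y}, 1{y↔b})` (test function `1{y↔b}`, increasing in `C_y`),
* S2: `Cov_D(1{o↔y}, 1{z↮b}) ≥ θ·Cov_D(1{x↔y}, 1{z↮b})` (test function `1{z↮b}`, decreasing in `C_z`).
**S1-gen** is S1 for an arbitrary increasing function `G` of the edge cluster `C_y` in place of `1{y↔b}`: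
`μ(W)·[μ(D)·∫_{X∩D} G(C_y) − μ(X∩D)·∫_D G(C_y)] ≤ μ(D_a)·[μ(D)·∫_{{o↔y}∩D} G(C_y) − μ({o↔y}∩D)·∫_D G(C_y)]`.
This file proves `S1-gen ⟹ S2` (`exchS2_of_exchS1_gen`): by the domain Markov property for the cluster of `y`
(van den Berg–Häggström–Kahn's display (10), tree theorem `BHK2006.sum_cond_cluster` with `s = y`, `t = z`), for every
event `Q` read off `C_y`,
`μ(Q ∩ {z↮b} ∩ D) = ∫_{Q∩D} G_κ(C_y) dμ`,  `G_κ(C) := Σ_η weight(η)·(1 − 1{z↔b}(η ∖ C̄))` (`C̄` = the pairs meeting `{y} ∪ V(C)`),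
and `G_κ` is increasing in `C` (`BHK2006.bar_mono`, `openEdgeCluster_mono`); so the S2 covariances are the S1-gen
covariances for the test function `G_κ`, and S2 is S1-gen at `G = G_κ` after complementing `{z↔b}` inside `D`.
Consequently the `|A| = 3` case of Kozma–Nitzan's Question 7 needs only S1-gen (worker report CexchS1.md, §3:
S1-gen ⟸ nonnegativity of the hole-averaged exchange covariance).
[cite: VandenbergHaggstromKahn2005, §1 pp. 7–8, display (10)] [cite: KozmaNitzan2024, Question 7 (p. 36)]
-/

namespace Summit.CriticalPhenomena.PercolationContinuityZ3.Theorems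

open MeasureTheory Set Literature.Probability.LatticeModels Literature.Probability.Percolation
open Literature.Probability.Percolation.BHK2006
open scoped Classical
open Q7ThreeCut
open DecisionTree (ind ind_of_mem ind_of_not_mem ind_nonneg)

noncomputable section

variable {n : ℕ}

/-! ### Integrals against `prodBernoulli` as weighted sums -/

/-- A set integral against `prodBernoulli w` is the weighted finite sum with the indicator. [folklore] -/
theorem s1gen_setIntegral_eq_sum (w : Sym2 (Fin n) → unitInterval) (S : Set (BondConfig (Fin n)))
    (h : BondConfig (Fin n) → ℝ) :
    ∫ ω in S, h ω ∂(prodBernoulli w) = ∑ ω, weight (fun e => (w e : ℝ)) ω * (h ω * ind S ω) := by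
  rw [← integral_indicator (MeasurableSet.of_discrete : MeasurableSet S), integral_prodBernoulli_eq_sum]
  refine Finset.sum_congr rfl fun ω _ => ?_
  by_cases hω : ω ∈ S
  · rw [Set.indicator_of_mem hω, ind_of_mem hω, mul_one]
  · rw [Set.indicator_of_notMem hω, ind_of_not_mem hω]; ring

/-- The probability of an event under `prodBernoulli w` is the weighted sum of its indicator. [folklore] -/
theorem s1gen_measureReal_eq_sum (w : Sym2 (Fin n) → unitInterval) (S : Set (BondConfig (Fin n))) :
    (prodBernoulli w).real S = ∑ ω, weight (fun e => (w e : ℝ)) ω * ind S ω := by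
  rw [← integral_indicator_one (MeasurableSet.of_discrete : MeasurableSet S), integral_prodBernoulli_eq_sum]
  refine Finset.sum_congr rfl fun ω _ => ?_
  by_cases hω : ω ∈ S
  · rw [Set.indicator_of_mem hω, ind_of_mem hω, Pi.one_apply]
  · rw [Set.indicator_of_notMem hω, ind_of_not_mem hω, mul_zero]

/-- Total mass one in the weighted-sum language. [folklore] -/
theorem s1gen_sum_weight (w : Sym2 (Fin n) → unitInterval) : ∑ ω, weight (fun e => (w e : ℝ)) ω = 1 := by
  have h1 := integral_prodBernoulli_eq_sum w fun _ => (1 : ℝ)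
  simp only [integral_const, probReal_univ, smul_eq_mul, mul_one] at h1
  exact h1.symm

/-! ### The averaged non-connection functional `G_κ` -/

/-- **`G_κ` is increasing in the cluster**: `C ↦ Σ_η weight(η)·(1 − F_{z,b}(C_z(η ∖ C̄)))` is monotone, because
`C̄` grows with `C`, the cluster of `z` off `C̄` shrinks, and `F_{z,b}` is increasing.
[cite: VandenbergHaggstromKahn2005, §1 p. 8 (stochastic monotonicity of `C_t` given `C_s = W`)] -/
theorem s1gen_monotone_Gk (w : Sym2 (Fin n) → unitInterval) (b y z : Fin n) :
    Monotone fun C : Set (Sym2 (Fin n)) => ∑ η, weight (fun e => (w e : ℝ)) η *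
      (1 - connIndicatorFn z b (openEdgeCluster (η \ {e | ∃ v ∈ e, v = y ∨ ∃ e' ∈ C, v ∈ e'}) z)) := by
  intro C C' hCC'
  refine Finset.sum_le_sum fun η _ => mul_le_mul_of_nonneg_left ?_
    (weight_nonneg (fun e => (w e).2.1) (fun e => (w e).2.2) η)
  have hsub : η \ {e | ∃ v ∈ e, v = y ∨ ∃ e' ∈ C', v ∈ e'} ⊆ η \ {e | ∃ v ∈ e, v = y ∨ ∃ e' ∈ C, v ∈ e'} :=
    Set.sdiff_subset_sdiff_right (bar_mono y hCC')
  linarith [monotone_connIndicatorFn z b (openEdgeCluster_mono hsub z)]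

/-- **Markov property for the cluster of `y`**: for an event `Q` read off `C_y` (`q(C_y(ω)) = 1_Q(ω)`),
`μ(Q ∩ {z↮b} ∩ {y↮z}) = ∫_{Q ∩ {y↮z}} G_κ(C_y) dμ` — BHK's display (10) (`BHK2006.sum_cond_cluster`, `s = y`, `t = z`)
for `H(C_y, C_z) = q(C_y)·(1 − F_{z,b}(C_z))`.
[cite: VandenbergHaggstromKahn2005, §1 pp. 7–8, display (10)] -/
theorem s1gen_markov (w : Sym2 (Fin n) → unitInterval) (b y z : Fin n) (Q : Set (BondConfig (Fin n)))
    (q : Set (Sym2 (Fin n)) → ℝ) (hq : ∀ ω : BondConfig (Fin n), q (openEdgeCluster ω y) = ind Q ω) :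
    (prodBernoulli w).real (Q ∩ (openConn z b)ᶜ ∩ (openConn y z)ᶜ) =
      ∫ ω in Q ∩ (openConn y z)ᶜ, (∑ η, weight (fun e => (w e : ℝ)) η *
        (1 - connIndicatorFn z b (openEdgeCluster
          (η \ {e | ∃ v ∈ e, v = y ∨ ∃ e' ∈ openEdgeCluster ω y, v ∈ e'}) z))) ∂(prodBernoulli w) := by
  set D : Set (BondConfig (Fin n)) := (openConn y z)ᶜ with hD
  have hDiff : ∀ ω : BondConfig (Fin n), ω ∈ D ↔ ¬ (openGraph ω).Reachable y z := fun ω => Iff.rfl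
  have hcond := sum_cond_cluster (fun e => (w e : ℝ)) (s1gen_sum_weight w) y z
    (fun Cy Cz => q Cy * (1 - connIndicatorFn z b Cz)) hDiff
  -- the left-hand side as a sum
  have hind : ∀ ω : BondConfig (Fin n), ind (Q ∩ (openConn z b)ᶜ ∩ D) ω =
      q (openEdgeCluster ω y) * (1 - connIndicatorFn z b (openEdgeCluster ω z)) * ind D ω := by
    intro ω
    rw [ind_inter, ind_inter, hq, connIndicatorFn_openEdgeCluster]
    congr 2
    by_cases hzb : ω ∈ (openConn z b : Set (BondConfig (Fin n)))
    · rw [ind_of_not_mem (Set.notMem_compl_iff.2 hzb), indicator_of_mem hzb, Pi.one_apply]; ring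
    · rw [ind_of_mem (Set.mem_compl hzb), indicator_of_notMem hzb]; ring
  rw [s1gen_measureReal_eq_sum, s1gen_setIntegral_eq_sum]
  simp only [hind]
  rw [hcond]
  refine Finset.sum_congr rfl fun ω _ => ?_
  set B : Set (Sym2 (Fin n)) := {e | ∃ v ∈ e, v = y ∨ ∃ e' ∈ openEdgeCluster ω y, v ∈ e'} with hB
  have hpull : (∑ η, weight (fun e => (w e : ℝ)) η *
      (q (openEdgeCluster ω y) * (1 - connIndicatorFn z b (openEdgeCluster (η \ B) z)))) =
      q (openEdgeCluster ω y) * ∑ η, weight (fun e => (w e : ℝ)) η *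
        (1 - connIndicatorFn z b (openEdgeCluster (η \ B) z)) := by
    rw [Finset.mul_sum]
    exact Finset.sum_congr rfl fun η _ => by ring
  rw [hpull, hq, ind_inter]
  ring

/-! ### S2 from S1-gen -/

/-- **S2 from the general-test-function form of S1.**  If S1 holds for every increasing function `G` of the
edge cluster of `y` (hypothesis `hS1`, the registered `stub_exchS1` being its instance `G = 1{y↔b}`), then S2 (the
registered `stub_exchS2`) holds: apply `hS1` to the increasing functional `G_κ(C) = P(z ↮ b off C̄)`
(`s1gen_monotone_Gk`) and use the Markov property `μ(Q ∩ {z↮b} ∩ D) = ∫_{Q∩D} G_κ(C_y)` (`s1gen_markov`) for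
`Q = {x↔y}, {o↔y}, Ω`, then complement `{z↔b}` inside `D`.
[cite: VandenbergHaggstromKahn2005, §1 pp. 7–8, display (10)] [cite: KozmaNitzan2024, Question 7 (p. 36)] -/
theorem exchS2_of_exchS1_gen (w : Sym2 (Fin n) → unitInterval) (o b x y z : Fin n)
    (hS1 : ∀ G : Set (Sym2 (Fin n)) → ℝ, Monotone G →
      (prodBernoulli w).real (((openConn x y)ᶜ ∩ (openConn x z)ᶜ) ∩ openConn o x) *
          ((prodBernoulli w).real (openConn y z)ᶜ *
              (∫ ω in openConn x y ∩ (openConn y z)ᶜ, G (openEdgeCluster ω y) ∂(prodBernoulli w)) -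
            (prodBernoulli w).real (openConn x y ∩ (openConn y z)ᶜ) *
              (∫ ω in (openConn y z)ᶜ, G (openEdgeCluster ω y) ∂(prodBernoulli w))) ≤
        (prodBernoulli w).real ((openConn x y)ᶜ ∩ (openConn x z)ᶜ) *
          ((prodBernoulli w).real (openConn y z)ᶜ *
              (∫ ω in openConn o y ∩ (openConn y z)ᶜ, G (openEdgeCluster ω y) ∂(prodBernoulli w)) -
            (prodBernoulli w).real (openConn o y ∩ (openConn y z)ᶜ) *
              (∫ ω in (openConn y z)ᶜ, G (openEdgeCluster ω y) ∂(prodBernoulli w)))) :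
    (prodBernoulli w).real (((openConn x y)ᶜ ∩ (openConn x z)ᶜ) ∩ openConn o x) *
        ((prodBernoulli w).real (openConn x y ∩ (openConn y z)ᶜ) *
            (prodBernoulli w).real (openConn z b ∩ (openConn y z)ᶜ) -
          (prodBernoulli w).real (openConn y z)ᶜ *
            (prodBernoulli w).real (openConn x y ∩ openConn z b ∩ (openConn y z)ᶜ)) ≤
      (prodBernoulli w).real ((openConn x y)ᶜ ∩ (openConn x z)ᶜ) *
        ((prodBernoulli w).real (openConn o y ∩ (openConn y z)ᶜ) *
            (prodBernoulli w).real (openConn z b ∩ (openConn y z)ᶜ) -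
          (prodBernoulli w).real (openConn y z)ᶜ *
            (prodBernoulli w).real (openConn o y ∩ openConn z b ∩ (openConn y z)ᶜ)) := by
  -- the averaged non-connection functional
  set Gk : Set (Sym2 (Fin n)) → ℝ := fun C => ∑ η, weight (fun e => (w e : ℝ)) η *
    (1 - connIndicatorFn z b (openEdgeCluster (η \ {e | ∃ v ∈ e, v = y ∨ ∃ e' ∈ C, v ∈ e'}) z)) with hGk
  have key := hS1 Gk (s1gen_monotone_Gk w b y z)
  -- the three Markov identities
  have hqX : ∀ ω : BondConfig (Fin n), connIndicatorFn y x (openEdgeCluster ω y) = ind (openConn x y) ω := by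
    intro ω
    rw [connIndicatorFn_openEdgeCluster, knThm2_openConn_comm y x]
    by_cases h : ω ∈ (openConn x y : Set (BondConfig (Fin n)))
    · rw [indicator_of_mem h, ind_of_mem h, Pi.one_apply]
    · rw [indicator_of_notMem h, ind_of_not_mem h]
  have hqO : ∀ ω : BondConfig (Fin n), connIndicatorFn y o (openEdgeCluster ω y) = ind (openConn o y) ω := by
    intro ω
    rw [connIndicatorFn_openEdgeCluster, knThm2_openConn_comm y o]
    by_cases h : ω ∈ (openConn o y : Set (BondConfig (Fin n)))
    · rw [indicator_of_mem h, ind_of_mem h, Pi.one_apply]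
    · rw [indicator_of_notMem h, ind_of_not_mem h]
  have hq1 : ∀ ω : BondConfig (Fin n), (fun _ : Set (Sym2 (Fin n)) => (1 : ℝ)) (openEdgeCluster ω y) =
      ind (univ : Set (BondConfig (Fin n))) ω := fun ω => by rw [ind_of_mem (mem_univ ω)]
  have mX := s1gen_markov w b y z (openConn x y) (connIndicatorFn y x) hqX
  have mO := s1gen_markov w b y z (openConn o y) (connIndicatorFn y o) hqO
  have m1 := s1gen_markov w b y z univ (fun _ => 1) hq1
  rw [univ_inter, univ_inter] at m1
  rw [← mX, ← mO, ← m1] at key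
  -- complements of `{z ↔ b}` inside `Q ∩ D`
  have hm : ∀ s : Set (BondConfig (Fin n)), MeasurableSet s := fun _ => MeasurableSet.of_discrete
  have compl : ∀ Q : Set (BondConfig (Fin n)),
      (prodBernoulli w).real (Q ∩ openConn z b ∩ (openConn y z)ᶜ) +
          (prodBernoulli w).real (Q ∩ (openConn z b)ᶜ ∩ (openConn y z)ᶜ) =
        (prodBernoulli w).real (Q ∩ (openConn y z)ᶜ) := by
    intro Q
    have h := measureReal_inter_add_sdiff (μ := prodBernoulli w) (s := Q ∩ (openConn y z)ᶜ)
      (t := openConn z b) (hm _)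
    have e1 : Q ∩ (openConn y z)ᶜ ∩ openConn z b = Q ∩ openConn z b ∩ (openConn y z)ᶜ := by
      ext ω; simp only [mem_inter_iff, mem_compl_iff]; tauto
    have e2 : (Q ∩ (openConn y z)ᶜ) \ openConn z b = Q ∩ (openConn z b)ᶜ ∩ (openConn y z)ᶜ := by
      ext ω; simp only [mem_sdiff, mem_inter_iff, mem_compl_iff]; tauto
    rw [e1, e2] at h
    exact h
  have cX := compl (openConn x y)
  have cO := compl (openConn o y)
  have c1 := compl univ
  rw [univ_inter, univ_inter, univ_inter] at c1
  -- linear arithmetic in the products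
  linear_combination key -
    ((prodBernoulli w).real (((openConn x y)ᶜ ∩ (openConn x z)ᶜ) ∩ openConn o x) *
        (prodBernoulli w).real (openConn y z)ᶜ) * cX +
    ((prodBernoulli w).real ((openConn x y)ᶜ ∩ (openConn x z)ᶜ) * (prodBernoulli w).real (openConn y z)ᶜ) * cO +
    ((prodBernoulli w).real (((openConn x y)ᶜ ∩ (openConn x z)ᶜ) ∩ openConn o x) *
          (prodBernoulli w).real (openConn x y ∩ (openConn y z)ᶜ) -
        (prodBernoulli w).real ((openConn x y)ᶜ ∩ (openConn x z)ᶜ) *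
          (prodBernoulli w).real (openConn o y ∩ (openConn y z)ᶜ)) * c1

/-! ### S1 from S1-gen, and registered-signature forms -/

/-- **S1 from S1-gen**: the registered `stub_exchS1` is the instance `G = 1{C ∈ {y ↔ b}}` of S1-gen (the edge cluster
`C_y(ω)` lies in `{y↔b}` iff `ω` does, `indicator_openConn_of_cluster_subset`). [folklore] -/
theorem exchS1_of_exchS1_gen (w : Sym2 (Fin n) → unitInterval) (o b x y z : Fin n)
    (hS1 : ∀ G : Set (Sym2 (Fin n)) → ℝ, Monotone G → (prodBernoulli w).real (((openConn x y)ᶜ ∩ (openConn x z)ᶜ) ∩ openConn o x) * ((prodBernoulli w).real (openConn y z)ᶜ * (∫ ω in openConn x y ∩ (openConn y z)ᶜ, G (openEdgeCluster ω y) ∂(prodBernoulli w)) - (prodBernoulli w).real (openConn x y ∩ (openConn y z)ᶜ) * (∫ ω in (openConn y z)ᶜ, G (openEdgeCluster ω y) ∂(prodBernoulli w))) ≤ (prodBernoulli w).real ((openConn x y)ᶜ ∩ (openConn x z)ᶜ) * ((prodBernoulli w).real (openConn y z)ᶜ * (∫ ω in openConn o y ∩ (openConn y z)ᶜ, G (openEdgeCluster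 ω y) ∂(prodBernoulli w)) - (prodBernoulli w).real (openConn o y ∩ (openConn y z)ᶜ) * (∫ ω in (openConn y z)ᶜ, G (openEdgeCluster ω y) ∂(prodBernoulli w)))) :
    (prodBernoulli w).real (((openConn x y)ᶜ ∩ (openConn x z)ᶜ) ∩ openConn o x) * ((prodBernoulli w).real (openConn y z)ᶜ * (prodBernoulli w).real (openConn x y ∩ openConn y b ∩ (openConn y z)ᶜ) - (prodBernoulli w).real (openConn x y ∩ (openConn y z)ᶜ) * (prodBernoulli w).real (openConn y b ∩ (openConn y z)ᶜ)) ≤ (prodBernoulli w).real ((openConn x y)ᶜ ∩ (openConn x z)ᶜ) * ((prodBernoulli w).real (openConn y z)ᶜ * (prodBernoulli w).real (openConn o y ∩ openConn y b ∩ (openConn y z)ᶜ) - (prodBernoulli w).real (openConn o y ∩ (openConn y z)ᶜ) * (prodBernoulli w).real (openConn y b ∩ (openConn y z)ᶜ)) := by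
  set G : Set (Sym2 (Fin n)) → ℝ := (openConn y b : Set (BondConfig (Fin n))).indicator 1 with hG
  have key := hS1 G (monotone_indicator_of_isUpperSet (isUpperSet_openConn y b))
  have eG : ∀ ω : BondConfig (Fin n), G (openEdgeCluster ω y) =
      (openConn y b : Set (BondConfig (Fin n))).indicator 1 ω := fun ω =>
    indicator_openConn_of_cluster_subset subset_rfl (openEdgeCluster_subset ω y)
  simp only [eG, setIntegral_indicator_one_eq] at key
  have e1 : (openConn x y ∩ (openConn y z)ᶜ ∩ openConn y b : Set (BondConfig (Fin n))) =
      openConn x y ∩ openConn y b ∩ (openConn y z)ᶜ := by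
    ext ω; simp only [mem_inter_iff, mem_compl_iff]; tauto
  have e2 : (openConn o y ∩ (openConn y z)ᶜ ∩ openConn y b : Set (BondConfig (Fin n))) =
      openConn o y ∩ openConn y b ∩ (openConn y z)ᶜ := by
    ext ω; simp only [mem_inter_iff, mem_compl_iff]; tauto
  have e3 : ((openConn y z)ᶜ ∩ openConn y b : Set (BondConfig (Fin n))) = openConn y b ∩ (openConn y z)ᶜ :=
    inter_comm _ _
  rw [e1, e2, e3] at key
  exact key

/-- **Registered-signature form**: S1-gen (for all graphs, all `o x y z` with `x, y, z` distinct, all increasing `G`)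
implies the registered `stub_exchS2` signature. [cite: KozmaNitzan2024, Question 7 (p. 36)] -/
theorem stub_exchS2_of_exchS1_gen
    (hS1 : ∀ (n : ℕ) (w : Sym2 (Fin n) → unitInterval) (o x y z : Fin n), x ≠ y → x ≠ z → y ≠ z → ∀ G : Set (Sym2 (Fin n)) → ℝ, Monotone G → (Literature.Probability.LatticeModels.prodBernoulli w).real (((Literature.Probability.Percolation.openConn x y)ᶜ ∩ (Literature.Probability.Percolation.openConn x z)ᶜ) ∩ Literature.Probability.Percolation.openConn o x) * ((Literature.Probability.LatticeModels.prodBernoulli w).real (Literature.Probability.Percolation.openConn y z)ᶜ * (∫ ω in Literature.Probability.Percolation.openConn x y ∩ (Literature.Probability.Percolation.openConn y z)ᶜ, G (Literature.Probability.Percolation.openEdgeCluster ω y) ∂(Literature.Probability.LatticeModels.prodBernoulli w)) - (Literature.Probability.LatticeModels.prodBernoulli w).real (Literature.Probability.Percolation.openConn x y ∩ (Literature.Probability.Percolation.openConn y z)ᶜ) * (∫ ω in (Literature.Probability.Percolation.openConn y z)ᶜ, G (Literature.Probability.Percolation.openEdgeCluster ω y) ∂(Literature.Probability.LatticeModels.prodBernoulli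 w))) ≤ (Literature.Probability.LatticeModels.prodBernoulli w).real ((Literature.Probability.Percolation.openConn x y)ᶜ ∩ (Literature.Probability.Percolation.openConn x z)ᶜ) * ((Literature.Probability.LatticeModels.prodBernoulli w).real (Literature.Probability.Percolation.openConn y z)ᶜ * (∫ ω in Literature.Probability.Percolation.openConn o y ∩ (Literature.Probability.Percolation.openConn y z)ᶜ, G (Literature.Probability.Percolation.openEdgeCluster ω y) ∂(Literature.Probability.LatticeModels.prodBernoulli w)) - (Literature.Probability.LatticeModels.prodBernoulli w).real (Literature.Probability.Percolation.openConn o y ∩ (Literature.Probability.Percolation.openConn y z)ᶜ) * (∫ ω in (Literature.Probability.Percolation.openConn y z)ᶜ, G (Literature.Probability.Percolation.openEdgeCluster ω y) ∂(Literature.Probability.LatticeModels.prodBernoulli w)))) :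
    ∀ (n : ℕ) (w : Sym2 (Fin n) → unitInterval) (o b x y z : Fin n), x ≠ y → x ≠ z → y ≠ z → (Literature.Probability.LatticeModels.prodBernoulli w).real (((Literature.Probability.Percolation.openConn x y)ᶜ ∩ (Literature.Probability.Percolation.openConn x z)ᶜ) ∩ Literature.Probability.Percolation.openConn o x) * ((Literature.Probability.LatticeModels.prodBernoulli w).real (Literature.Probability.Percolation.openConn x y ∩ (Literature.Probability.Percolation.openConn y z)ᶜ) * (Literature.Probability.LatticeModels.prodBernoulli w).real (Literature.Probability.Percolation.openConn z b ∩ (Literature.Probability.Percolation.openConn y z)ᶜ) - (Literature.Probability.LatticeModels.prodBernoulli w).real (Literature.Probability.Percolation.openConn y z)ᶜ * (Literature.Probability.LatticeModels.prodBernoulli w).real (Literature.Probability.Percolation.openConn x y ∩ Literature.Probability.Percolation.openConn z b ∩ (Literature.Probability.Percolation.openConn y z)ᶜ)) ≤ (Literature.Probability.LatticeModels.prodBernoulli w).real ((Literature.Probability.Percolation.openConn x y)ᶜ ∩ (Literature.Probability.Percolation.openConn x z)ᶜ) * ((Literature.Probability.LatticeModels.prodBernoulli w).real (Literature.Probability.Percolation.openConn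 o y ∩ (Literature.Probability.Percolation.openConn y z)ᶜ) * (Literature.Probability.LatticeModels.prodBernoulli w).real (Literature.Probability.Percolation.openConn z b ∩ (Literature.Probability.Percolation.openConn y z)ᶜ) - (Literature.Probability.LatticeModels.prodBernoulli w).real (Literature.Probability.Percolation.openConn y z)ᶜ * (Literature.Probability.LatticeModels.prodBernoulli w).real (Literature.Probability.Percolation.openConn o y ∩ Literature.Probability.Percolation.openConn z b ∩ (Literature.Probability.Percolation.openConn y z)ᶜ)) :=
  fun _ w o b x y z hxy hxz hyz => exchS2_of_exchS1_gen w o b x y z (hS1 _ w o x y z hxy hxz hyz)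

/-- **Registered-signature form**: S1-gen implies the registered `stub_exchS1` signature. [cite: KozmaNitzan2024, Question 7 (p. 36)] -/
theorem stub_exchS1_of_exchS1_gen
    (hS1 : ∀ (n : ℕ) (w : Sym2 (Fin n) → unitInterval) (o x y z : Fin n), x ≠ y → x ≠ z → y ≠ z → ∀ G : Set (Sym2 (Fin n)) → ℝ, Monotone G → (Literature.Probability.LatticeModels.prodBernoulli w).real (((Literature.Probability.Percolation.openConn x y)ᶜ ∩ (Literature.Probability.Percolation.openConn x z)ᶜ) ∩ Literature.Probability.Percolation.openConn o x) * ((Literature.Probability.LatticeModels.prodBernoulli w).real (Literature.Probability.Percolation.openConn y z)ᶜ * (∫ ω in Literature.Probability.Percolation.openConn x y ∩ (Literature.Probability.Percolation.openConn y z)ᶜ, G (Literature.Probability.Percolation.openEdgeCluster ω y) ∂(Literature.Probability.LatticeModels.prodBernoulli w)) - (Literature.Probability.LatticeModels.prodBernoulli w).real (Literature.Probability.Percolation.openConn x y ∩ (Literature.Probability.Percolation.openConn y z)ᶜ) * (∫ ω in (Literature.Probability.Percolation.openConn y z)ᶜ, G (Literature.Probability.Percolation.openEdgeCluster ω y) ∂(Literature.Probability.LatticeModels.prodBernoulli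 w))) ≤ (Literature.Probability.LatticeModels.prodBernoulli w).real ((Literature.Probability.Percolation.openConn x y)ᶜ ∩ (Literature.Probability.Percolation.openConn x z)ᶜ) * ((Literature.Probability.LatticeModels.prodBernoulli w).real (Literature.Probability.Percolation.openConn y z)ᶜ * (∫ ω in Literature.Probability.Percolation.openConn o y ∩ (Literature.Probability.Percolation.openConn y z)ᶜ, G (Literature.Probability.Percolation.openEdgeCluster ω y) ∂(Literature.Probability.LatticeModels.prodBernoulli w)) - (Literature.Probability.LatticeModels.prodBernoulli w).real (Literature.Probability.Percolation.openConn o y ∩ (Literature.Probability.Percolation.openConn y z)ᶜ) * (∫ ω in (Literature.Probability.Percolation.openConn y z)ᶜ, G (Literature.Probability.Percolation.openEdgeCluster ω y) ∂(Literature.Probability.LatticeModels.prodBernoulli w)))) :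
    ∀ (n : ℕ) (w : Sym2 (Fin n) → unitInterval) (o b x y z : Fin n), x ≠ y → x ≠ z → y ≠ z → (Literature.Probability.LatticeModels.prodBernoulli w).real (((Literature.Probability.Percolation.openConn x y)ᶜ ∩ (Literature.Probability.Percolation.openConn x z)ᶜ) ∩ Literature.Probability.Percolation.openConn o x) * ((Literature.Probability.LatticeModels.prodBernoulli w).real (Literature.Probability.Percolation.openConn y z)ᶜ * (Literature.Probability.LatticeModels.prodBernoulli w).real (Literature.Probability.Percolation.openConn x y ∩ Literature.Probability.Percolation.openConn y b ∩ (Literature.Probability.Percolation.openConn y z)ᶜ) - (Literature.Probability.LatticeModels.prodBernoulli w).real (Literature.Probability.Percolation.openConn x y ∩ (Literature.Probability.Percolation.openConn y z)ᶜ) * (Literature.Probability.LatticeModels.prodBernoulli w).real (Literature.Probability.Percolation.openConn y b ∩ (Literature.Probability.Percolation.openConn y z)ᶜ)) ≤ (Literature.Probability.LatticeModels.prodBernoulli w).real ((Literature.Probability.Percolation.openConn x y)ᶜ ∩ (Literature.Probability.Percolation.openConn x z)ᶜ) * ((Literature.Probability.LatticeModels.prodBernoulli w).real (Literature.Probability.Percolation.openConn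 y z)ᶜ * (Literature.Probability.LatticeModels.prodBernoulli w).real (Literature.Probability.Percolation.openConn o y ∩ Literature.Probability.Percolation.openConn y b ∩ (Literature.Probability.Percolation.openConn y z)ᶜ) - (Literature.Probability.LatticeModels.prodBernoulli w).real (Literature.Probability.Percolation.openConn o y ∩ (Literature.Probability.Percolation.openConn y z)ᶜ) * (Literature.Probability.LatticeModels.prodBernoulli w).real (Literature.Probability.Percolation.openConn y b ∩ (Literature.Probability.Percolation.openConn y z)ᶜ)) :=
  fun _ w o b x y z hxy hxz hyz => exchS1_of_exchS1_gen w o b x y z (hS1 _ w o x y z hxy hxz hyz)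

end

end Summit.CriticalPhenomena.PercolationContinuityZ3.Theorems
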